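import Summits.ABC.IUTFork.Cor312Steps
import HarnessLib

/-!
# [IUTchIII] Cor. 3.12, proof chain — the identification-of-copies ledger (étale side)

Record-only file (D-0012) of the abc-iut cell (D-0067 Cor. 3.12 strategy TEAM C «étale-picture /
multiradiality», seat abc-iut-c312-13, row C-2 of `HOME/plan/C312-TEAMS.md`); TAKES NO SIDE. For each of
the twenty printed nodes of the proof of [IUTchIII] Cor. 3.12 (c312-2's `Cor312Proof.Step`, kurims
`paper:url-4b091feeb646` pp. 174–186) this file records WHICH KIND OF IDENTIFICATION OF COPIES the node
consumes — the question at the centre of the dispute (Scholze–Stix 2018 §2.2: the proof identifies copies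
of objects that the formalism distinguishes; the author, Rmk 3.11.1 (ii): the gluing by the full
poly-isomorphism is deliberate). The ledger is a READING of the page, but it is NOT free-floating: every
assignment is machine-checked against c312-2's landed per-node data (`idents_justified`, by `decide`) —
an identification kind may be assigned to a node only if one of that kind's marker loci is cited by the
node or one of its marker observations is drawn or invoked by the node. Headlines (all `decide`):

* `setLevel_only_at_xi_f` — the SET-LEVEL identification (the q-pilot image treated as one of / inside
  the hull of the possible Θ-pilot images: `Obs.constitutesConstruction`, the content LANA §9.2 (9-1)
  isolates and `c312-4`'s `mainGoal_is_the_extra_input` proves the types do not force) enters the chain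
  at EXACTLY ONE node, (xi-f) — every other node consumes only gluing-, Kummer-, indeterminacy-orbit- or
  volume-level identifications.
* `fullPoly_census` / `identFree_steps` — which nodes ride on full-poly-isomorphism gluings (for which
  the typed compatibilities are THEOREMS that constrain nothing: `Thm311LinkCompat.partIIIa_holds` /
  `partIIIb_holds`, `PolyIsoCalc.sqCommutes_full`; LANA Rem. 8.2.1: "a vacuous assertion since the
  category of BPSs is a connected groupoid"), and which nodes carry no identification at all.

Kinds and their typed homes (consumers: Team A per-step readings, Team R census, the GAP-LEDGER wording):
`fullPoly` ← Thm 3.11 (iii)(a)(b) as typed (`Thm311.PartIIIa/b`, PROVED vacuous-as-typed); `nonFullPerm`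
← (iii)(c)(d) (`Thm311.PartIIIc/d`, HYPOTHESES); `kummerEquiv` ← Thm 3.11 (ii) (c312-1 `Thm311.Column`);
`ind3Union` ← (Ind3) (`Setting.thetaRegion3`); `indOrbit` ← (Ind1)(Ind2) orbit well-definedness
(`Cor312MultiradTwist` when landed); `volInvariance` ← `MRData.LogvolInvariant`; `labelDelta` ←
[IUTchII] Cor. 4.10 (i) `△`; `qGluing` ← the Θ-pilot ↦ q-pilot value-group gluing (c312-8
`Cor312Rmk.bitw_link_eq_univ`); `conjSync` ← conjugate synchronization / profinite conjugacy resolution;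
`globalCopies` ← the copies of `F_mod` as translation apparatus; `setLevelInclusion` ← (xi-f).
[claim: Mochizuki2012, status: disputed] for every page-reading; the checks are [folklore] bookkeeping.
Deliberately NOT here: whether any identification is LICENSED (that is the dispute); per-step `Holds`
readings (Team A); the identified-copies hypothesis and its collapse (Team R); any judgement.
-/

namespace Summit.ABC

namespace IUTFork

namespace Cor312Proof

open Locus Obs

/-! ## 1. The kinds of identification of copies -/

/-- The KINDS of identification of copies the proof of Cor. 3.12 consumes, as read on pp. 174–186
(classification of the étale/multiradiality team; the typed home of each kind is in the module
docstring). [claim: Mochizuki2012, status: disputed] -/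
inductive Ident
  /-- gluing along a FULL poly-isomorphism (the Θ×μ_LGP-link and its portions; Thm 3.11 (iii)(a)(b);
  bi-coricity of Thm 1.5 (iii)(iv)) — vacuous as typed: `partIIIa_holds`/`partIIIb_holds` -/
  | fullPoly
  /-- the NON-full poly-isomorphisms of the étale-picture permutation symmetries (Thm 3.11 (iii)(c)(d),
  Rmk 3.11.2) — typed as the HYPOTHESES `PartIIIc`/`PartIIId` -/
  | nonFullPerm
  /-- the Kummer isomorphisms / log-Kummer correspondence identifying Frobenius-picture copies with the
  étale-picture containers (Thm 3.11 (ii)) -/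
  | kummerEquiv
  /-- the `m`-indexed copies identified only through their UNION ((Ind3), upper semi-compatibility) -/
  | ind3Union
  /-- well-definedness on the (Ind1)(Ind2)-orbit (the possible images as one class) -/
  | indOrbit
  /-- identification of log-volumes across the indeterminacies (`MRData.LogvolInvariant`; degrees as
  log-volumes) -/
  | volInvariance
  /-- the label identification `△` of [IUTchII] Cor. 4.10 (i) ("identifying the labels 0 and `⟨F_l^⋇⟩`") -/
  | labelDelta
  /-- the Θ-pilot ↦ q-pilot correspondence through the value-group portion of the link (the gluing
  `(b^itw)`; Rmk 3.12.2 (ii)(iv)(v)) -/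
  | qGluing
  /-- conjugate synchronization / resolution of profinite conjugacy indeterminacies ([IUTchI] §2,
  [IUTchII] §2) -/
  | conjSync
  /-- the copies of `F_mod` / `F^⊛_MOD` vs `F^⊛_mod` as "translation apparatus" (Rmk 3.10.1) -/
  | globalCopies
  /-- the SET-LEVEL identification: the q-pilot image counted among / inside the hull of the possible
  Θ-pilot images ((xi-f) "constitutes … a construction"; Scholze–Stix §2.2; LANA (9-1)) -/
  | setLevelInclusion
  deriving DecidableEq, Repr

namespace Ident

/-- All eleven kinds. [folklore] -/
def all : List Ident :=
  [fullPoly, nonFullPerm, kummerEquiv, ind3Union, indOrbit, volInvariance, labelDelta, qGluing,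
   conjSync, globalCopies, setLevelInclusion]

/-- The list of kinds is complete. [folklore] -/
theorem mem_all (κ : Ident) : κ ∈ all := by cases κ <;> decide

/-- MARKER LOCI of a kind: a node may be assigned the kind only if it cites one of these loci (or draws /
invokes one of the marker observations, `obsMarkers`) — the kernel-checked tie between this ledger and
c312-2's per-node data. [claim: Mochizuki2012, status: disputed] -/
def lociMarkers : Ident → List Locus
  | fullPoly => [thm3_11_iii_a, thm3_11_iii_b, def3_8_ii, def2_4_iii, thm1_5_iii, thm1_5_iv, IPL]
  | nonFullPerm => [thm3_11_iii_c, thm3_11_iii_d, thm3_11_i_perm, rem3_11_2]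
  | kummerEquiv => [thm3_11_ii_a, thm3_11_ii_b, thm3_11_ii_c, thm3_11_ii_logvol]
  | ind3Union => [Ind3]
  | indOrbit => [Ind1, Ind2]
  | volInvariance => [prop3_9_ii, prop3_9_iv, thm3_11_ii_logvol, rem3_10_1, prop3_9_iii]
  | labelDelta => [chII_cor4_10_i]
  | qGluing => [def3_8_ii, rem3_12_2_ii, rem3_12_2_iv, rem3_12_2_v]
  | conjSync => [chII_sec2, chI_sec2, chI_rem6_12_4_iii]
  | globalCopies => [rem3_10_1, rem3_6_2_i]
  | setLevelInclusion => []

/-- MARKER OBSERVATIONS of a kind (drawn or invoked). [claim: Mochizuki2012, status: disputed] -/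
def obsMarkers : Ident → List Obs
  | fullPoly => [linkSplits, valueGroupLinkFullPolyIso, linkAsGluing]
  | nonFullPerm => [symmetriesSeparate, symmetriesMultiradial]
  | kummerEquiv => [logKummerViaGaloisEvaluation, unitsRelatedContainers, oneColumnLogKummerRectifies,
      frobeniusLikeRelatedToCoric]
  | ind3Union => [verticalShiftSolved]
  | indOrbit => [unitsSubjectInd12, kummerDetachmentInd123]
  | volInvariance => [logvolInvariantInequality, logvolLogLinkCompatible, degreesAsLogVolumes,
      twoEquivalentWays]
  | labelDelta => []
  | qGluing => [valueGroupMapsPilots, linkAsGluing, sheMeansFixedValue, twoEquivalentWays]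
  | conjSync => [conjugacyIndetResolved, conjSyncLogLinkCompatible]
  | globalCopies => [fmodTranslation]
  | setLevelInclusion => [constitutesConstruction]

end Ident

/-! ## 2. The ledger: which identifications each node consumes -/

/-- **THE LEDGER**: for each printed node, the kinds of identification of copies it consumes, READ ON THE
PAGE (pp. 174–186; page/line per node = the `Step` docstrings of `Cor312Steps.lean`). Assignments are
tied to c312-2's data by `idents_justified`. [claim: Mochizuki2012, status: disputed] -/
def Step.idents : Step → List Ident
  | .wlog => [.indOrbit, .ind3Union]
  | .i => [.fullPoly, .qGluing]
  | .ii => [.fullPoly, .nonFullPerm, .indOrbit]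
  | .iii => []
  | .iv => [.kummerEquiv, .ind3Union]
  | .v => [.fullPoly, .kummerEquiv]
  | .vi => [.kummerEquiv, .conjSync]
  | .vii => [.nonFullPerm, .kummerEquiv]
  | .viii => [.conjSync]
  | .ix => [.globalCopies, .ind3Union]
  | .x => [.indOrbit, .volInvariance, .ind3Union, .kummerEquiv, .fullPoly, .nonFullPerm]
  | .xi_a => [.qGluing, .fullPoly]
  | .xi_b => [.fullPoly, .nonFullPerm, .indOrbit]
  | .xi_c => []
  | .xi_d => [.volInvariance, .kummerEquiv]
  | .xi_e => [.fullPoly, .qGluing]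
  | .xi_f => [.setLevelInclusion]
  | .xi_g => [.qGluing, .volInvariance]
  | .xi_h => []
  | .xii => []

/-- **Every assignment is justified by c312-2's landed data**: a kind assigned to a node has a marker
locus among the node's citations, or a marker observation among the node's drawn or invoked
observations. Machine-checked. [folklore] -/
theorem idents_justified : ∀ s ∈ Step.all, ∀ κ ∈ s.idents,
    (∃ c ∈ κ.lociMarkers, c ∈ s.cites) ∨ ∃ o ∈ κ.obsMarkers, o ∈ s.concl ∨ o ∈ s.uses := by
  decide

/-! ## 3. Headlines -/

/-- **THE SET-LEVEL IDENTIFICATION ENTERS AT EXACTLY ONE NODE, (xi-f)** (p. 184 l. 19–29): every other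
node of the proof consumes only gluing-, Kummer-, indeterminacy-orbit-, synchronization- or volume-level
identifications. Combined with c312-2's `xi_f_data` ((xi-f) cites no locus beyond (xi-e)'s) and c312-4's
`mainGoal_is_the_extra_input` (the types do not force it), this pins the disputed content of the proof to
one printed sentence. [claim: Mochizuki2012, status: disputed] -/
theorem setLevel_only_at_xi_f : ∀ s ∈ Step.all, Ident.setLevelInclusion ∈ s.idents ↔ s = .xi_f := by
  decide

/-- The nodes that consume a FULL-poly-isomorphism gluing — for which the typed Thm 3.11 (iii)(a)(b)
compatibilities are theorems that constrain nothing (`partIIIa_holds`/`partIIIb_holds`,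
`PolyIsoCalc.sqCommutes_full`; LANA Rem. 8.2.1): the opening link nodes, the summary, and the (xi)
assembly — by printed index: (i), (ii), (v), (x), (xi-a), (xi-b), (xi-e). [folklore] -/
theorem fullPoly_census :
    (Step.all.filter fun s => Ident.fullPoly ∈ s.idents).map Step.idx = [1, 2, 5, 10, 11, 12, 15] := by
  decide

/-- The nodes that consume NO identification of copies at all: (iii) (single-link necessity), (xi-c)
(hull enlargement display), (xi-h) ([EtTh] dependence), (xii) (why global Frobenioids) — by printed
index. [folklore] -/
theorem identFree_steps :
    (Step.all.filter fun s => s.idents = []).map Step.idx = [3, 13, 18, 19] := by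
  decide

/-- The volume-level identifications ((Ind1)(Ind2)-invariance of log-volumes, degrees as log-volumes)
are consumed at (x), (xi-d), (xi-g) — the estimate-side nodes; each is typed as a hypothesis
(`MRData.LogvolInvariant`, `DegreesViaLogvol`) whose real discharge is Team A/B work (rows A-1, B-2,
B-4). [folklore] -/
theorem volInvariance_census :
    (Step.all.filter fun s => Ident.volInvariance ∈ s.idents).map Step.idx = [10, 14, 17] := by
  decide

/-- The (Ind1)(Ind2)-orbit identifications are consumed at the opening paragraph, (ii), (x), (xi-b) —
exactly the nodes that read the multiradial representation "up to indeterminacies". Their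
well-definedness is pure orbit algebra (`Cor312MultiradTwist`, row C-1). [folklore] -/
theorem indOrbit_census :
    (Step.all.filter fun s => Ident.indOrbit ∈ s.idents).map Step.idx = [0, 2, 10, 12] := by
  decide

/-- Every kind except `labelDelta` is consumed by some node; `labelDelta` (the `△` of [IUTchII]
Cor. 4.10 (i)) is consumed by the STATEMENT itself (`Step.statementCites` carries `chII_cor4_10_i`) and
reaches the chain through the statement's q-pilot vocabulary, not through a node. [folklore] -/
theorem labelDelta_statement_only :
    (∀ s ∈ Step.all, Ident.labelDelta ∉ s.idents) ∧ chII_cor4_10_i ∈ Step.statementCites := by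
  decide

/-- Census: number of nodes consuming each kind, in the order of `Ident.all`
(fullPoly 7 · nonFullPerm 4 · kummerEquiv 6 · ind3Union 4 · indOrbit 4 · volInvariance 3 · labelDelta 0 ·
qGluing 4 · conjSync 2 · globalCopies 1 · setLevelInclusion 1). [folklore] -/
theorem ident_counts :
    Ident.all.map (fun κ => (Step.all.filter fun s => κ ∈ s.idents).length) =
      [7, 4, 6, 4, 4, 3, 0, 4, 2, 1, 1] := by
  decide

end Cor312Proof

end IUTFork

end Summit.ABC
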